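import Summits.CriticalPhenomena.PercolationContinuityZ3.Theorems.PercNearOneGluingNoHeavyLowerTailMajorityGluingTypeTableFacts
import HarnessLib

/-!
# The clean certificates of the abstract `(4,3)` programme at the level of laws — THEOREM CC instances
(lane prim-rate, constants-miner 1, gen 27; CLEAN-CERTIFICATES.md §1–§3, §8; CONVEX-BOOTSTRAP.md §1)

Support file for the closed crux `NoHeavyLowerTail` (stmt-CriticalPhenomena-4575), majority-gluing line; companion of
`…MajorityGluingTypeTable` (definitions) and `…MajorityGluingTypeTableFacts` (the `decide`d table facts).
A LAW is any `x : DType → ℝ` with `x ≥ 0` (masses on the 94 types; the lane's scale-free laws have `Σ_{cut₁} x = 1`,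
which is not needed here); `lin φ x = Σ_τ φ(τ)x_τ`; a linear row of the programme is the HYPOTHESIS `lin feat x ≤ 0`,
a van den Berg–Kahn pair row is a HYPOTHESIS on products of event masses — exactly as in the lane's records, whose
percolation meaning is not the business of this file.

* THE ENGINE (`cc_bound`, `cc_eq`): a typewise inequality `combo L ≤ 0` (resp. identity `= 0`) integrates to
  `Σ_p c_p·lin(φ_p)(x) ≤ 0` (resp. `= 0`) for every nonnegative law — THEOREM CC of CLEAN-CERTIFICATES §1 with the
  quadratic rows kept as separate hypotheses;
* LEMMA B for laws: `E ≤ T_w` under the budget `B_w` (`w = 2,3,4`), `E = T₁ − x(Q)`; the relay-root row in reduced form;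
* USTAR₁..₄: `2E ≤ u_{S̄_w} − 2Σ_{z≠w} x(C_{wz})`, and with the hub-pair rows
  `x(all cut)·2E ≤ x(all cut)·u_{S̄_w} − 2T_wΣ_{z≠w}T_z` (BENCH l.234 M1-USTAR as printed);
* QS1: `16E ≤ Σ_S u_S − 6Σ_g x(C_g)` and `x(all cut)·16E ≤ x(all cut)·Σ_S u_S − 6e₂(T)`; EIGHTH: `8E ≤ u₁₂₃ + u₁₂₄`;
  MIX: `24E ≤ 2u₁₂₃₄ + Σ_S u_S`;
* the STAR_w certificates (with glued-pair terms, θ-form) and R207 follow in `…MajorityGluingTypeTableStarCertificates`.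

Linear real arithmetic over the kernel-checked table facts; no definitions, no sorries.
[cite: VandenbergHaggstromKahn2005, Thm. 1.3 (p. 6)]
-/

namespace Summit.CriticalPhenomena.PercolationContinuityZ3.Theorems

namespace HubOnly
namespace TypeTable

noncomputable section
open DType

/-! ### Linear functionals of laws: the engine of THEOREM CC -/

/-- Linearity of the weighted list sum in the functional. -/
private theorem sum_map_lin (l : List DType) (a : ℤ) (φ ψ : DType → ℤ) (x : DType → ℝ) :
    (l.map fun τ => ((a * φ τ + ψ τ : ℤ) : ℝ) * x τ).sum =
      a * (l.map fun τ => (φ τ : ℝ) * x τ).sum + (l.map fun τ => (ψ τ : ℝ) * x τ).sum := by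
  induction l with
  | nil => simp
  | cons τ l ih =>
    simp only [List.map_cons, List.sum_cons, ih]
    push_cast
    ring

/-- A typewise nonpositive functional has a nonpositive weighted sum. -/
private theorem sum_map_nonpos (l : List DType) (φ : DType → ℤ) (x : DType → ℝ)
    (hφ : ∀ τ ∈ l, φ τ ≤ 0) (hx : ∀ τ, 0 ≤ x τ) : (l.map fun τ => (φ τ : ℝ) * x τ).sum ≤ 0 := by
  induction l with
  | nil => simp
  | cons τ l ih =>
    simp only [List.map_cons, List.sum_cons]
    have h1 : (φ τ : ℝ) * x τ ≤ 0 :=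
      mul_nonpos_of_nonpos_of_nonneg (by exact_mod_cast hφ τ (by simp)) (hx τ)
    have h2 := ih (fun σ hσ => hφ σ (by simp [hσ]))
    linarith

/-- The zero functional has weighted sum zero. -/
private theorem sum_map_zero (l : List DType) (x : DType → ℝ) :
    (l.map fun τ => (((fun _ => (0 : ℤ)) τ : ℤ) : ℝ) * x τ).sum = 0 := by
  induction l with
  | nil => simp
  | cons τ l ih => simp [List.map_cons, List.sum_cons]

/-- `lin` of an integer combination is the combination of the `lin`s. -/
theorem lin_combo (L : List (ℤ × (DType → ℤ))) (x : DType → ℝ) :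
    lin (combo L) x = (L.map fun p => (p.1 : ℝ) * lin p.2 x).sum := by
  induction L with
  | nil => simp [lin, combo]
  | cons p L ih =>
    have hc : combo (p :: L) = fun τ => p.1 * p.2 τ + combo L τ := by
      funext τ; simp [combo, List.map_cons, List.sum_cons]
    rw [hc, List.map_cons, List.sum_cons, ← ih]
    exact sum_map_lin allTypes p.1 p.2 (combo L) x

/-- A typewise nonpositive functional has nonpositive mass under every nonnegative law. -/
theorem lin_nonpos {φ : DType → ℤ} {x : DType → ℝ} (hφ : ∀ τ ∈ allTypes, φ τ ≤ 0) (hx : ∀ τ, 0 ≤ x τ) :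
    lin φ x ≤ 0 := sum_map_nonpos allTypes φ x hφ hx

/-- A typewise vanishing functional has zero mass under every law. -/
theorem lin_eq_zero {φ : DType → ℤ} {x : DType → ℝ} (hφ : ∀ τ ∈ allTypes, φ τ = 0) : lin φ x = 0 := by
  unfold lin
  have : (allTypes.map fun τ => ((φ τ : ℤ) : ℝ) * x τ) =
      allTypes.map fun τ => (((fun _ => (0 : ℤ)) τ : ℤ) : ℝ) * x τ :=
    List.map_congr_left fun τ hτ => by simp [hφ τ hτ]
  rw [this, sum_map_zero]

/-- An indicator functional has a nonnegative weighted sum. -/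
private theorem sum_map_nonneg (l : List DType) (A : DType → Bool) (x : DType → ℝ) (hx : ∀ τ, 0 ≤ x τ) :
    0 ≤ (l.map fun τ => (ind (A τ) : ℝ) * x τ).sum := by
  induction l with
  | nil => simp
  | cons τ l ih =>
    simp only [List.map_cons, List.sum_cons]
    have h1 : 0 ≤ (ind (A τ) : ℝ) * x τ :=
      mul_nonneg (by unfold ind; split <;> simp) (hx τ)
    linarith

/-- Event masses are nonnegative under a nonnegative law. -/
theorem lin_ind_nonneg (A : DType → Bool) {x : DType → ℝ} (hx : ∀ τ, 0 ≤ x τ) :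
    0 ≤ lin (fun τ => ind (A τ)) x := sum_map_nonneg allTypes A x hx

/-- **THEOREM CC (the engine; CLEAN-CERTIFICATES §1).**  If the integer-scaled reduced cost of a certificate `L` is
`≤ 0` on every type of the table, then for every nonnegative law `Σ_p c_p·lin(φ_p)(x) ≤ 0` — i.e. `d·E(x)` is at most
the certificate's combination of row values, isolation masses and pair masses. -/
theorem cc_bound (L : List (ℤ × (DType → ℤ))) (x : DType → ℝ) (hL : ∀ τ ∈ allTypes, combo L τ ≤ 0)
    (hx : ∀ τ, 0 ≤ x τ) : (L.map fun p => (p.1 : ℝ) * lin p.2 x).sum ≤ 0 := by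
  rw [← lin_combo]; exact lin_nonpos hL hx

/-- A typewise identity `combo L = 0` gives the linear identity `Σ_p c_p·lin(φ_p)(x) = 0` for every law. -/
theorem cc_eq (L : List (ℤ × (DType → ℤ))) (x : DType → ℝ) (hL : ∀ τ ∈ allTypes, combo L τ = 0) :
    (L.map fun p => (p.1 : ℝ) * lin p.2 x).sum = 0 := by
  rw [← lin_combo]; exact lin_eq_zero hL

/-! ### LEMMA B at the level of laws -/

/-- **LEMMA B (law level; CLEAN-CERTIFICATES §3).**  For `w ∈ {2,3,4}` and every nonnegative law obeying the budget row
`B_w(x) ≤ 0` (`δ_w ≤ δ₁`): `E(x) ≤ T_w(x) − x(v_w cut, v₁ att, N ≤ 2) − x(Q ∩ {v_w cut}) ≤ T_w(x)`. -/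
theorem E_le_T (w : ℕ) (hw : w ∈ [2, 3, 4]) (x : DType → ℝ) (hx : ∀ τ, 0 ≤ x τ)
    (hB : lin (fun τ => τ.bud w) x ≤ 0) :
    E x ≤ Tm w x - lin (fun τ => ind (τ.cut w && τ.att 1 && decide (τ.ncut ≤ 2))) x
      - lin (fun τ => ind (τ.eZ == -1 && τ.cut w)) x ∧ E x ≤ Tm w x := by
  have h := cc_eq _ x (fun τ hτ => lemmaB_combo τ hτ w hw)
  simp only [List.map_cons, List.map_nil, List.sum_cons, List.sum_nil] at h
  have h1 := lin_ind_nonneg (fun τ => τ.cut w && τ.att 1 && decide (τ.ncut ≤ 2)) hx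
  have h2 := lin_ind_nonneg (fun τ => τ.eZ == -1 && τ.cut w) hx
  push_cast at h
  simp only [E]
  constructor <;> linarith

/-- `E(x) = T₁(x) − x(Q)` for every law; in particular `E ≤ T₁` and, with `E_le_T`, `E ≤ T_min` under the budgets. -/
theorem E_eq_T1_sub_Q (x : DType → ℝ) : E x = Tm 1 x - lin (fun τ => ind (τ.eZ == -1)) x := by
  have h := cc_eq _ x lemmaB_one_combo
  simp only [List.map_cons, List.map_nil, List.sum_cons, List.sum_nil] at h
  push_cast at h
  simp only [E]
  linarith

/-- The relay-root van den Berg–Kahn row `x(A_j)·x(B_j) ≤ x(C_j)·x(D_j)` (`j = (r, {x,y})`, `z` the fourth relay) in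
REDUCED FORM: `x(G_{rz})·T_r(x) ≤ x(C_{rz})·x(D_r)` with `x(D_r) = T_r(x) + S_r(x)` (CLEAN-CERTIFICATES §1, proof of
THEOREM CC: `A_j = G ⊔ D_j`, `C_j = C_g ⊔ B_j`, `B_j = T_r`, `D_j = T_r ⊔ S_r`). -/
theorem relay_row_reduced (r a b : ℕ) (hr : r ∈ [1, 2, 3, 4]) (ha : a ∈ [1, 2, 3, 4]) (hb : b ∈ [1, 2, 3, 4])
    (hra : r ≠ a) (hrb : r ≠ b) (hab : a < b) (x : DType → ℝ)
    (row : lin (fun τ => ind (τ.isA r a b)) x * lin (fun τ => ind (τ.isBj r)) x ≤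
      lin (fun τ => ind (τ.isCj r a b)) x * lin (fun τ => ind (τ.isD r)) x) :
    lin (fun τ => ind (τ.isG r (10 - r - a - b))) x * Tm r x ≤ Cm r (10 - r - a - b) x * (Tm r x + Sm r x) ∧
      lin (fun τ => ind (τ.isD r)) x = Tm r x + Sm r x := by
  have h := fun τ hτ => relayRoot_combo τ hτ r hr a ha b hb hra hrb hab
  have hA := cc_eq _ x (fun τ hτ => (h τ hτ).1)
  have hC := cc_eq _ x (fun τ hτ => (h τ hτ).2.1)
  have hD := cc_eq _ x (fun τ hτ => (h τ hτ).2.2)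
  simp only [List.map_cons, List.map_nil, List.sum_cons, List.sum_nil] at hA hC hD
  push_cast at hA hC hD
  have eA : lin (fun τ => ind (τ.isA r a b)) x = lin (fun τ => ind (τ.isG r (10 - r - a - b))) x +
      lin (fun τ => ind (τ.isD r)) x := by linarith
  have eC : lin (fun τ => ind (τ.isCj r a b)) x = Cm r (10 - r - a - b) x + Tm r x := by
    simp only [Cm, Tm, DType.isBj] at hC ⊢; linarith
  have eD : lin (fun τ => ind (τ.isD r)) x = Tm r x + Sm r x := by simp only [Tm, Sm]; linarith
  have eB : lin (fun τ => ind (τ.isBj r)) x = Tm r x := by simp only [Tm, DType.isBj]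
  refine ⟨?_, eD⟩
  rw [eA, eC, eB, eD] at row
  nlinarith [row]

/-! ### The universal star certificates USTAR_w (gen 25, BENCH l.234 M1-USTAR) -/

/-- **USTAR₁, linear form.**  For every nonnegative law with the rows `B₂`, `O_dn4_23`, `O_up4_23` (`≤ 0`):
`2E ≤ u₂₃₄ − 2·(x(C₁₂) + x(C₁₃) + x(C₁₄))`. -/
theorem ustar1 (x : DType → ℝ) (hx : ∀ τ, 0 ≤ x τ) (hB2 : lin (fun τ => τ.bud 2) x ≤ 0)
    (hO1 : lin (fun τ => τ.odn 4 2 3) x ≤ 0) (hO2 : lin (fun τ => τ.oup 4 2 3) x ≤ 0) :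
    2 * E x ≤ uS [2, 3, 4] x - 2 * (Cm 1 2 x + Cm 1 3 x + Cm 1 4 x) := by
  have h := cc_bound _ x rc_USTAR1 hx
  simp only [List.map_cons, List.map_nil, List.sum_cons, List.sum_nil] at h
  push_cast at h
  simp only [E, uS, Cm]
  linarith

/-- **USTAR₂, linear form** (rows `Cpair_34`, `CaloneY_3_2`): `2E ≤ u₁₃₄ − 2·(x(C₁₂) + x(C₂₃) + x(C₂₄))`. -/
theorem ustar2 (x : DType → ℝ) (hx : ∀ τ, 0 ≤ x τ) (h1 : lin (fun τ => τ.cpair 3 4) x ≤ 0)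
    (h2 : lin (fun τ => τ.caloneY 3 2) x ≤ 0) :
    2 * E x ≤ uS [1, 3, 4] x - 2 * (Cm 1 2 x + Cm 2 3 x + Cm 2 4 x) := by
  have h := cc_bound _ x rc_USTAR2 hx
  simp only [List.map_cons, List.map_nil, List.sum_cons, List.sum_nil] at h
  push_cast at h
  simp only [E, uS, Cm]
  linarith

/-- **USTAR₃, linear form** (rows `Cpair_24`, `CaloneY_2_3`): `2E ≤ u₁₂₄ − 2·(x(C₁₃) + x(C₂₃) + x(C₃₄))`. -/
theorem ustar3 (x : DType → ℝ) (hx : ∀ τ, 0 ≤ x τ) (h1 : lin (fun τ => τ.cpair 2 4) x ≤ 0)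
    (h2 : lin (fun τ => τ.caloneY 2 3) x ≤ 0) :
    2 * E x ≤ uS [1, 2, 4] x - 2 * (Cm 1 3 x + Cm 2 3 x + Cm 3 4 x) := by
  have h := cc_bound _ x rc_USTAR3 hx
  simp only [List.map_cons, List.map_nil, List.sum_cons, List.sum_nil] at h
  push_cast at h
  simp only [E, uS, Cm]
  linarith

/-- **USTAR₄, linear form** (rows `Cpair_23`, `CaloneY_2_4`): `2E ≤ u₁₂₃ − 2·(x(C₁₄) + x(C₂₄) + x(C₃₄))`. -/
theorem ustar4 (x : DType → ℝ) (hx : ∀ τ, 0 ≤ x τ) (h1 : lin (fun τ => τ.cpair 2 3) x ≤ 0)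
    (h2 : lin (fun τ => τ.caloneY 2 4) x ≤ 0) :
    2 * E x ≤ uS [1, 2, 3] x - 2 * (Cm 1 4 x + Cm 2 4 x + Cm 3 4 x) := by
  have h := cc_bound _ x rc_USTAR4 hx
  simp only [List.map_cons, List.map_nil, List.sum_cons, List.sum_nil] at h
  push_cast at h
  simp only [E, uS, Cm]
  linarith

/-- The hub-pair step (pure real arithmetic): a linear star bound `dE ≤ u − d(C₁ + C₂ + C₃)` and the three van den
Berg–Kahn hub-pair rows `T·T_i ≤ C_i·x(all cut)` give `x(all cut)·dE ≤ x(all cut)·u − d·T·(T₁ + T₂ + T₃)`. -/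
theorem hub_step {d Ex u AC T T1 T2 T3 C1 C2 C3 : ℝ} (hd : 0 ≤ d) (hAC : 0 ≤ AC)
    (hlin : d * Ex ≤ u - d * (C1 + C2 + C3)) (hub1 : T * T1 ≤ C1 * AC) (hub2 : T * T2 ≤ C2 * AC)
    (hub3 : T * T3 ≤ C3 * AC) : AC * (d * Ex) ≤ AC * u - d * (T * (T1 + T2 + T3)) := by
  have h := mul_le_mul_of_nonneg_left hlin hAC
  nlinarith

/-- **USTAR_w with the hub-pair rows** (the printed form of BENCH l.234: `E ≤ ½u_{S̄_w} − T_w·Σ_{z≠w}T_z/x(all cut)`):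
for `w = 1`: `x(all cut)·2E ≤ x(all cut)·u₂₃₄ − 2·T₁·(T₂ + T₃ + T₄)`. -/
theorem ustar1_hub (x : DType → ℝ) (hx : ∀ τ, 0 ≤ x τ) (hB2 : lin (fun τ => τ.bud 2) x ≤ 0)
    (hO1 : lin (fun τ => τ.odn 4 2 3) x ≤ 0) (hO2 : lin (fun τ => τ.oup 4 2 3) x ≤ 0)
    (hub2 : Tm 1 x * Tm 2 x ≤ Cm 1 2 x * ACm x) (hub3 : Tm 1 x * Tm 3 x ≤ Cm 1 3 x * ACm x)
    (hub4 : Tm 1 x * Tm 4 x ≤ Cm 1 4 x * ACm x) :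
    ACm x * (2 * E x) ≤ ACm x * uS [2, 3, 4] x - 2 * (Tm 1 x * (Tm 2 x + Tm 3 x + Tm 4 x)) :=
  hub_step (by norm_num) (lin_ind_nonneg _ hx) (ustar1 x hx hB2 hO1 hO2) hub2 hub3 hub4

/-- USTAR₂ with the hub-pair rows: `x(all cut)·2E ≤ x(all cut)·u₁₃₄ − 2·T₂·(T₁ + T₃ + T₄)`. -/
theorem ustar2_hub (x : DType → ℝ) (hx : ∀ τ, 0 ≤ x τ) (h1 : lin (fun τ => τ.cpair 3 4) x ≤ 0)
    (h2 : lin (fun τ => τ.caloneY 3 2) x ≤ 0)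
    (hub1 : Tm 2 x * Tm 1 x ≤ Cm 1 2 x * ACm x) (hub3 : Tm 2 x * Tm 3 x ≤ Cm 2 3 x * ACm x)
    (hub4 : Tm 2 x * Tm 4 x ≤ Cm 2 4 x * ACm x) :
    ACm x * (2 * E x) ≤ ACm x * uS [1, 3, 4] x - 2 * (Tm 2 x * (Tm 1 x + Tm 3 x + Tm 4 x)) :=
  hub_step (by norm_num) (lin_ind_nonneg _ hx) (ustar2 x hx h1 h2) hub1 hub3 hub4

/-- USTAR₃ with the hub-pair rows: `x(all cut)·2E ≤ x(all cut)·u₁₂₄ − 2·T₃·(T₁ + T₂ + T₄)`. -/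
theorem ustar3_hub (x : DType → ℝ) (hx : ∀ τ, 0 ≤ x τ) (h1 : lin (fun τ => τ.cpair 2 4) x ≤ 0)
    (h2 : lin (fun τ => τ.caloneY 2 3) x ≤ 0)
    (hub1 : Tm 3 x * Tm 1 x ≤ Cm 1 3 x * ACm x) (hub2 : Tm 3 x * Tm 2 x ≤ Cm 2 3 x * ACm x)
    (hub4 : Tm 3 x * Tm 4 x ≤ Cm 3 4 x * ACm x) :
    ACm x * (2 * E x) ≤ ACm x * uS [1, 2, 4] x - 2 * (Tm 3 x * (Tm 1 x + Tm 2 x + Tm 4 x)) :=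
  hub_step (by norm_num) (lin_ind_nonneg _ hx) (ustar3 x hx h1 h2) hub1 hub2 hub4

/-- USTAR₄ with the hub-pair rows: `x(all cut)·2E ≤ x(all cut)·u₁₂₃ − 2·T₄·(T₁ + T₂ + T₃)`. -/
theorem ustar4_hub (x : DType → ℝ) (hx : ∀ τ, 0 ≤ x τ) (h1 : lin (fun τ => τ.cpair 2 3) x ≤ 0)
    (h2 : lin (fun τ => τ.caloneY 2 4) x ≤ 0)
    (hub1 : Tm 4 x * Tm 1 x ≤ Cm 1 4 x * ACm x) (hub2 : Tm 4 x * Tm 2 x ≤ Cm 2 4 x * ACm x)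
    (hub3 : Tm 4 x * Tm 3 x ≤ Cm 3 4 x * ACm x) :
    ACm x * (2 * E x) ≤ ACm x * uS [1, 2, 3] x - 2 * (Tm 4 x * (Tm 1 x + Tm 2 x + Tm 3 x)) :=
  hub_step (by norm_num) (lin_ind_nonneg _ hx) (ustar4 x hx h1 h2) hub1 hub2 hub3

/-! ### QS1, EIGHTH, MIX (gen 25, CONVEX-BOOTSTRAP §1) -/

/-- **QS1, linear form** (its 16 linear rows as hypotheses): `16E ≤ (u₁₂₃ + u₁₂₄ + u₁₃₄ + u₂₃₄) − 6·Σ_g x(C_g)`. -/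
theorem qs1 (x : DType → ℝ) (hx : ∀ τ, 0 ≤ x τ)
    (r1 : lin (fun τ => τ.bud 2) x ≤ 0) (r2 : lin (fun τ => τ.bud 3) x ≤ 0)
    (r3 : lin (fun τ => τ.calone 2) x ≤ 0) (r4 : lin (fun τ => τ.calone 3) x ≤ 0)
    (r5 : lin (fun τ => τ.calone 4) x ≤ 0) (r6 : lin (fun τ => τ.cpair 3 4) x ≤ 0)
    (r7 : lin (fun τ => τ.cnotfull 2) x ≤ 0) (r8 : lin (fun τ => τ.cnotfull 3) x ≤ 0)
    (r9 : lin (fun τ => τ.cnotfull 4) x ≤ 0) (r10 : lin (fun τ => τ.cnotalone 2) x ≤ 0)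
    (r11 : lin (fun τ => τ.oalone 2 3) x ≤ 0) (r12 : lin (fun τ => τ.oalone 2 4) x ≤ 0)
    (r13 : lin (fun τ => τ.oalone 3 4) x ≤ 0) (r14 : lin (fun τ => τ.oupany 2 3) x ≤ 0)
    (r15 : lin (fun τ => τ.oupany 2 4) x ≤ 0) (r16 : lin (fun τ => τ.oupany 3 4) x ≤ 0) :
    16 * E x ≤ (uS [1, 2, 3] x + uS [1, 2, 4] x + uS [1, 3, 4] x + uS [2, 3, 4] x)
      - 6 * (Cm 1 2 x + Cm 1 3 x + Cm 1 4 x + Cm 2 3 x + Cm 2 4 x + Cm 3 4 x) := by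
  have h := cc_bound _ x rc_QS1.1 hx
  simp only [List.map_cons, List.map_nil, List.sum_cons, List.sum_nil] at h
  push_cast at h
  simp only [E, uS, Cm]
  linarith

/-- **QS1 with the six hub-pair rows** (the printed `E ≤ (1/16)Σ_S u_S − (3/8)e₂(T)/x(all cut)`):
`x(all cut)·16E ≤ x(all cut)·Σ_S u_S − 6·e₂(T)`, `e₂(T) = Σ_{w<z} T_wT_z`. -/
theorem qs1_hub (x : DType → ℝ) (hx : ∀ τ, 0 ≤ x τ)
    (r1 : lin (fun τ => τ.bud 2) x ≤ 0) (r2 : lin (fun τ => τ.bud 3) x ≤ 0)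
    (r3 : lin (fun τ => τ.calone 2) x ≤ 0) (r4 : lin (fun τ => τ.calone 3) x ≤ 0)
    (r5 : lin (fun τ => τ.calone 4) x ≤ 0) (r6 : lin (fun τ => τ.cpair 3 4) x ≤ 0)
    (r7 : lin (fun τ => τ.cnotfull 2) x ≤ 0) (r8 : lin (fun τ => τ.cnotfull 3) x ≤ 0)
    (r9 : lin (fun τ => τ.cnotfull 4) x ≤ 0) (r10 : lin (fun τ => τ.cnotalone 2) x ≤ 0)
    (r11 : lin (fun τ => τ.oalone 2 3) x ≤ 0) (r12 : lin (fun τ => τ.oalone 2 4) x ≤ 0)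
    (r13 : lin (fun τ => τ.oalone 3 4) x ≤ 0) (r14 : lin (fun τ => τ.oupany 2 3) x ≤ 0)
    (r15 : lin (fun τ => τ.oupany 2 4) x ≤ 0) (r16 : lin (fun τ => τ.oupany 3 4) x ≤ 0)
    (hub12 : Tm 1 x * Tm 2 x ≤ Cm 1 2 x * ACm x) (hub13 : Tm 1 x * Tm 3 x ≤ Cm 1 3 x * ACm x)
    (hub14 : Tm 1 x * Tm 4 x ≤ Cm 1 4 x * ACm x) (hub23 : Tm 2 x * Tm 3 x ≤ Cm 2 3 x * ACm x)
    (hub24 : Tm 2 x * Tm 4 x ≤ Cm 2 4 x * ACm x) (hub34 : Tm 3 x * Tm 4 x ≤ Cm 3 4 x * ACm x) :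
    ACm x * (16 * E x) ≤ ACm x * (uS [1, 2, 3] x + uS [1, 2, 4] x + uS [1, 3, 4] x + uS [2, 3, 4] x)
      - 6 * (Tm 1 x * Tm 2 x + Tm 1 x * Tm 3 x + Tm 1 x * Tm 4 x + Tm 2 x * Tm 3 x + Tm 2 x * Tm 4 x
        + Tm 3 x * Tm 4 x) := by
  have h := mul_le_mul_of_nonneg_left
    (qs1 x hx r1 r2 r3 r4 r5 r6 r7 r8 r9 r10 r11 r12 r13 r14 r15 r16) (lin_ind_nonneg (fun τ => τ.allCut) hx)
  simp only [ACm, Cm, Tm] at *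
  nlinarith [hub12, hub13, hub14, hub23, hub24, hub34, h]

/-- **EIGHTH** (its 8 linear rows as hypotheses): `8E ≤ u₁₂₃ + u₁₂₄` — a pure LINEAR majorisation. -/
theorem eighth (x : DType → ℝ) (hx : ∀ τ, 0 ≤ x τ)
    (r1 : lin (fun τ => τ.bud 2) x ≤ 0) (r2 : lin (fun τ => τ.calone 2) x ≤ 0)
    (r3 : lin (fun τ => τ.calone 3) x ≤ 0) (r4 : lin (fun τ => τ.calone 4) x ≤ 0)
    (r5 : lin ctriple x ≤ 0) (r6 : lin (fun τ => τ.cnotalone 2) x ≤ 0)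
    (r7 : lin (fun τ => τ.oalone 2 3) x ≤ 0) (r8 : lin (fun τ => τ.oalone 2 4) x ≤ 0) :
    8 * E x ≤ uS [1, 2, 3] x + uS [1, 2, 4] x := by
  have h := cc_bound _ x rc_EIGHTH.1 hx
  simp only [List.map_cons, List.map_nil, List.sum_cons, List.sum_nil] at h
  push_cast at h
  simp only [E, uS]
  linarith

/-- **MIX** (its 14 linear rows as hypotheses): `24E ≤ 2u₁₂₃₄ + (u₁₂₃ + u₁₂₄ + u₁₃₄ + u₂₃₄)`. -/
theorem mix (x : DType → ℝ) (hx : ∀ τ, 0 ≤ x τ)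
    (r1 : lin (fun τ => τ.bud 2) x ≤ 0) (r2 : lin (fun τ => τ.bud 3) x ≤ 0)
    (r3 : lin (fun τ => τ.calone 2) x ≤ 0) (r4 : lin (fun τ => τ.calone 3) x ≤ 0)
    (r5 : lin (fun τ => τ.calone 4) x ≤ 0) (r6 : lin (fun τ => τ.cnotalone 2) x ≤ 0)
    (r7 : lin (fun τ => τ.cnotalone 3) x ≤ 0) (r8 : lin (fun τ => τ.cnotalone 4) x ≤ 0)
    (r9 : lin (fun τ => τ.oalone 2 3) x ≤ 0) (r10 : lin (fun τ => τ.oalone 2 4) x ≤ 0)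
    (r11 : lin (fun τ => τ.oalone 3 4) x ≤ 0) (r12 : lin (fun τ => τ.oupany 2 3) x ≤ 0)
    (r13 : lin (fun τ => τ.oupany 2 4) x ≤ 0) (r14 : lin (fun τ => τ.oupany 3 4) x ≤ 0) :
    24 * E x ≤ 2 * uS [1, 2, 3, 4] x + (uS [1, 2, 3] x + uS [1, 2, 4] x + uS [1, 3, 4] x + uS [2, 3, 4] x) := by
  have h := cc_bound _ x rc_MIX.1 hx
  simp only [List.map_cons, List.map_nil, List.sum_cons, List.sum_nil] at h
  push_cast at h
  simp only [E, uS]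
  linarith


end

end TypeTable
end HubOnly

end Summit.CriticalPhenomena.PercolationContinuityZ3.Theorems
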